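import Mathlib

/-!
# Route BarrierLever — item `PartitionMinorsHitByVP` (stmt-ValiantsHypothesis-19717), line `hidden-states`:
# THE MEMBER-SIZE BOUND — a join family that is good against rows of size `≤ t` has no member with more than `t` states

Helper file (`--supports stmt-ValiantsHypothesis-19717`; cell valiant-natproofs, rung V4, 𝒟-side door (c), registered line
`Cruxes/PartitionMinorsHitByVP/Lines/hidden_states.lean` v2, lane `stub_universalJoinWide`; prover seat val-np-p3 gen 10).
Definition-free, Mathlib-only. Closes NO item: it is the first NEGATIVE structural fact about JOIN families (all earlier kernel
negatives of the line concern a single cube), a necessary condition every universal design must meet.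

THE POINT. A column `(p, J)` of a join family is the hidden point `z_J = c + Σ_{q∈J} s_q` of an affine image of the cube
`{0,1}^K`; the row `U` evaluates the monomial `x^U`, i.e. the product of `|U|` affine functions of `y ∈ {0,1}^K`, a function of
`y`-degree `≤ |U|`. Its `(|J₀|)`-th finite difference over the subcube `{S ⊆ J₀}` therefore vanishes as soon as `|U| < |J₀|`
(`alt_sum_prod_eq_zero`: `Σ_{S ⊆ J₀} (−1)^{|S|} ∏_{a∈U} (c_a + Σ_{q∈S} s_{q,a}) = 0`, by induction on `|U|` via `∏(L + s) − ∏ L`).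
A threshold family is down-closed (`mem_range_of_subset`), so all `S ⊆ J₀` are columns, and the signed indicator of the subcube is a
nonzero kernel vector: **if every row has size `≤ t` and some member has `≥ t+1` states, the block-additive matrix is singular for
EVERY table** (`det_eq_zero_of_large_member`).

CONSEQUENCE (`card_le_of_good`, necessary condition (T) of memo val-np-p3 g10): a join family that is good for even ONE row family of
sets of size `≤ t` — e.g. a universal family at `(h, r)` with `r ≤ |B_t(h)|`, tested against `r` sets of size `≤ t` — has all its
members of size `≤ t`. With `t*(r) = min {t : |B_t(h)| ≥ r}`: universal designs live inside the radius-`t*(r)` balls of their pieces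
(deep sub-cubes are excluded; e.g. no piece may be a full cube `2^{[n]}` with `n > t*(r)`). The finer profile condition
(N_j) `Σ_p #{members of piece p with < j states} ≥ min (r, |B_{j−1}(h)|)` follows from the same differences (rank form; not here).

WHAT THIS IS NOT: no statement about which families ARE good; item 19717 OPEN; nothing on crux 14610 or VP ≠ VNP.
-/

set_option linter.dupNamespace false

namespace Summit.ValiantsHypothesis.ValiantsHypothesis.Theorems.BarrierLever.HiddenStates

open Finset Matrix

noncomputable section

namespace MemberBound

variable {h K : ℕ}

/-! ## 1. The finite-difference identity -/

/-- The affine functional of the subset `S` at coordinate `a`: `c_a + Σ_{q ∈ S} s_{q,a}`. -/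
theorem lin_insert (c : Fin h → ℂ) (s : Fin K → Fin h → ℂ) (S : Finset (Fin K)) (q : Fin K) (hq : q ∉ S) (a : Fin h) :
    c a + ∑ q' ∈ insert q S, s q' a = s q a + (c a + ∑ q' ∈ S, s q' a) := by
  rw [Finset.sum_insert hq]; ring

/-- **The alternating subcube sum vanishes**: for `|U| < |T|`,
`Σ_{S ⊆ T} (−1)^{|S|} ∏_{a ∈ U} (c_a + Σ_{q ∈ S} s_{q,a}) = 0` (the `|T|`-th difference of a function of degree `≤ |U|`). -/
theorem alt_sum_prod_eq_zero (s : Fin K → Fin h → ℂ) :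
    ∀ (n : ℕ) (U : Finset (Fin h)) (c : Fin h → ℂ) (T : Finset (Fin K)), U.card ≤ n → U.card < T.card →
      ∑ S ∈ T.powerset, (-1 : ℂ) ^ S.card * ∏ a ∈ U, (c a + ∑ q ∈ S, s q a) = 0 := by
  intro n
  induction n with
  | zero =>
    intro U c T hU hUT
    have hU0 : U = ∅ := Finset.card_eq_zero.mp (Nat.le_zero.mp hU)
    subst hU0
    simp only [Finset.prod_empty, mul_one]
    have hT : T.Nonempty := Finset.card_pos.mp (by simpa using hUT)
    have := Finset.sum_powerset_neg_one_pow_card_of_nonempty hT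
    exact_mod_cast this
  | succ n ih =>
    intro U c T hU hUT
    -- T is nonempty: pick q ∈ T and write T = insert q T₀
    have hTne : T.Nonempty := Finset.card_pos.mp (by omega)
    obtain ⟨q, hq⟩ := hTne
    set T₀ := T.erase q with hT₀
    have hqT₀ : q ∉ T₀ := Finset.notMem_erase q T
    have hT : T = insert q T₀ := (Finset.insert_erase hq).symm
    have hcardT₀ : T₀.card = T.card - 1 := Finset.card_erase_of_mem hq
    rw [hT, Finset.powerset_insert, Finset.sum_union (Finset.disjoint_iff_ne.mpr ?disj)]
    case disj =>
      intro S hS S' hS' hSS'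
      rw [Finset.mem_powerset] at hS
      obtain ⟨S'', -, rfl⟩ := Finset.mem_image.mp hS'
      exact hqT₀ (hS (hSS' ▸ Finset.mem_insert_self q S''))
    rw [Finset.sum_image (fun S hS S' hS' hSS' => ?inj)]
    case inj =>
      rw [Finset.mem_coe, Finset.mem_powerset] at hS hS'
      have hqS : q ∉ S := fun h' => hqT₀ (hS h')
      have hqS' : q ∉ S' := fun h' => hqT₀ (hS' h')
      rw [← Finset.erase_insert hqS, ← Finset.erase_insert hqS', hSS']
    -- combine the two sums over S ⊆ T₀
    rw [← Finset.sum_add_distrib]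
    -- each pair of terms: (−1)^|S| g(S) + (−1)^{|S|+1} g(S ∪ q) = −(−1)^|S| (g(S ∪ q) − g(S))
    have hterm : ∀ S ∈ T₀.powerset,
        (-1 : ℂ) ^ S.card * ∏ a ∈ U, (c a + ∑ q' ∈ S, s q' a)
          + (-1 : ℂ) ^ (insert q S).card * ∏ a ∈ U, (c a + ∑ q' ∈ insert q S, s q' a)
        = -((-1 : ℂ) ^ S.card * ∑ V ∈ U.powerset.erase ∅,
              (∏ a ∈ V, s q a) * ∏ a ∈ U \ V, (c a + ∑ q' ∈ S, s q' a)) := by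
      intro S hS
      rw [Finset.mem_powerset] at hS
      have hqS : q ∉ S := fun h' => hqT₀ (hS h')
      rw [Finset.card_insert_of_notMem hqS, pow_succ]
      simp_rw [lin_insert c s S q hqS]
      -- ∏ (s_q + L) = Σ_{V ⊆ U} ∏_{V} s_q ∏_{U\V} L
      have hexp : ∏ a ∈ U, (s q a + (c a + ∑ q' ∈ S, s q' a))
          = ∑ V ∈ U.powerset, (∏ a ∈ V, s q a) * ∏ a ∈ U \ V, (c a + ∑ q' ∈ S, s q' a) :=
        Finset.prod_add _ _ _
      rw [hexp, ← Finset.add_sum_erase _ _ (Finset.empty_mem_powerset U)]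
      simp only [Finset.prod_empty, Finset.sdiff_empty, one_mul]
      ring
    rw [Finset.sum_congr rfl hterm, Finset.sum_neg_distrib, neg_eq_zero]
    -- swap the sums and apply the induction hypothesis to U \ V
    simp_rw [Finset.mul_sum]
    rw [Finset.sum_comm]
    refine Finset.sum_eq_zero fun V hV => ?_
    have hVne : V ≠ ∅ := Finset.ne_of_mem_erase hV
    have hVU : V ⊆ U := Finset.mem_powerset.mp (Finset.mem_of_mem_erase hV)
    have hcalc : ∀ S ∈ T₀.powerset, (-1 : ℂ) ^ S.card * ((∏ a ∈ V, s q a) * ∏ a ∈ U \ V, (c a + ∑ q' ∈ S, s q' a))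
        = (∏ a ∈ V, s q a) * ((-1 : ℂ) ^ S.card * ∏ a ∈ U \ V, (c a + ∑ q' ∈ S, s q' a)) := fun S _ => by ring
    rw [Finset.sum_congr rfl hcalc, ← Finset.mul_sum]
    have hcardV : 0 < V.card := Finset.card_pos.mpr (Finset.nonempty_iff_ne_empty.mpr hVne)
    have hVcard : V.card ≤ U.card := Finset.card_le_card hVU
    have hcardUV : (U \ V).card = U.card - V.card := Finset.card_sdiff_of_subset hVU
    have h1 : (U \ V).card ≤ n := by omega
    have h2 : (U \ V).card < T₀.card := by omega
    rw [ih (U \ V) c T₀ h1 h2, mul_zero]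

/-! ## 2. Threshold families are down-closed -/

variable {m r : ℕ}

/-- In a strict threshold family, every subset of a member (in the same piece) is a member. -/
theorem mem_range_of_subset (e : Fin r → Fin m × Finset (Fin K)) (W : Fin m → ℕ) (wt : Fin m → Fin K → ℕ)
    (hthr : ∀ x : Fin m × Finset (Fin K), x ∉ Set.range e →
      ∀ i, W (e i).1 + ∑ k ∈ (e i).2, wt (e i).1 k < W x.1 + ∑ k ∈ x.2, wt x.1 k)
    (k : Fin r) (S : Finset (Fin K)) (hS : S ⊆ (e k).2) : ((e k).1, S) ∈ Set.range e := by
  by_contra hx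
  have := hthr _ hx k
  have hle : ∑ q ∈ S, wt (e k).1 q ≤ ∑ q ∈ (e k).2, wt (e k).1 q :=
    Finset.sum_le_sum_of_subset_of_nonneg hS fun _ _ _ => Nat.zero_le _
  simp only at this
  omega

/-! ## 3. The singular subcube -/

/-- **THE MEMBER-SIZE BOUND.** If every row has size `≤ t`, the family is injective and down-closed in the piece of a column `k₀`
whose member `J₀` has more than `t` states, then the block-additive matrix is singular for EVERY table: the signed indicator of
the subcube `{(p₀, S) : S ⊆ J₀}` is in the kernel. -/
theorem det_eq_zero_of_large_member (u : Fin r → Finset (Fin h)) (t : ℕ) (hu : ∀ i, (u i).card ≤ t)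
    (e : Fin r → Fin m × Finset (Fin K)) (he : Function.Injective e)
    (k₀ : Fin r) (hk₀ : t < ((e k₀).2).card)
    (hdown : ∀ S, S ⊆ (e k₀).2 → ((e k₀).1, S) ∈ Set.range e)
    (tx : Fin m → Option (Fin K) → Fin h → ℂ) :
    (Matrix.of fun i k : Fin r =>
      ∏ a ∈ u i, (tx (e k).1 none a + ∑ q ∈ (e k).2, tx (e k).1 (some q) a)).det = 0 := by
  classical
  set p₀ := (e k₀).1 with hp₀
  set J₀ := (e k₀).2 with hJ₀
  -- the kernel vector
  let v : Fin r → ℂ := fun k => if (e k).1 = p₀ ∧ (e k).2 ⊆ J₀ then (-1 : ℂ) ^ ((e k).2).card else 0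
  have hv0 : v ≠ 0 := by
    intro h0
    have := congrFun h0 k₀
    simp only [v, Pi.zero_apply, ← hp₀, ← hJ₀, Finset.Subset.refl, and_self, if_true] at this
    exact (pow_ne_zero _ (neg_ne_zero.mpr one_ne_zero)) this
  refine Matrix.exists_mulVec_eq_zero_iff.mp ⟨v, hv0, ?_⟩
  funext i
  rw [Matrix.mulVec, dotProduct, Pi.zero_apply]
  simp only [Matrix.of_apply]
  -- restrict the sum to the subcube columns A = {k : e k ∈ {p₀} × 𝒫(J₀)}
  let A : Finset (Fin r) := Finset.univ.filter fun k => (e k).1 = p₀ ∧ (e k).2 ⊆ J₀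
  have hsplit : ∑ k, (∏ a ∈ u i, (tx (e k).1 none a + ∑ q ∈ (e k).2, tx (e k).1 (some q) a)) * v k
      = ∑ k ∈ A, (-1 : ℂ) ^ ((e k).2).card *
          ∏ a ∈ u i, (tx p₀ none a + ∑ q ∈ (e k).2, tx p₀ (some q) a) := by
    rw [← Finset.sum_filter_add_sum_filter_not Finset.univ (fun k => (e k).1 = p₀ ∧ (e k).2 ⊆ J₀)]
    rw [Finset.sum_eq_zero (s := Finset.univ.filter fun k => ¬((e k).1 = p₀ ∧ (e k).2 ⊆ J₀))
      (fun k hk => by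
        have hk' := (Finset.mem_filter.mp hk).2
        simp only [v, if_neg hk', mul_zero]), add_zero]
    refine Finset.sum_congr rfl fun k hk => ?_
    have hk' := (Finset.mem_filter.mp hk).2
    simp only [v, if_pos hk', hk'.1]
    ring
  rw [hsplit]
  -- reindex by S = (e k).2 ∈ 𝒫(J₀)
  set F : Finset (Fin K) → ℂ := fun S =>
    (-1 : ℂ) ^ S.card * ∏ a ∈ u i, (tx p₀ none a + ∑ q ∈ S, tx p₀ (some q) a) with hF
  have hre : ∑ k ∈ A, F (e k).2 = ∑ S ∈ J₀.powerset, F S := by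
    refine Finset.sum_nbij (fun k => (e k).2) ?_ ?_ ?_ (fun _ _ => rfl)
    · intro k hk
      exact Finset.mem_powerset.mpr (Finset.mem_filter.mp hk).2.2
    · intro k hk k' hk' hkk
      have h1 := (Finset.mem_filter.mp (Finset.mem_coe.mp hk)).2.1
      have h2 := (Finset.mem_filter.mp (Finset.mem_coe.mp hk')).2.1
      apply he
      exact Prod.ext (h1.trans h2.symm) hkk
    · intro S hS
      have hS' : S ⊆ J₀ := Finset.mem_powerset.mp (Finset.mem_coe.mp hS)
      obtain ⟨k, hk⟩ := hdown S hS'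
      refine ⟨k, Finset.mem_coe.mpr (Finset.mem_filter.mpr ⟨Finset.mem_univ _, ?_, ?_⟩), ?_⟩
      · rw [hk]
      · rw [hk]; exact hS'
      · show (e k).2 = S
        rw [hk]
  have hF' : ∀ k ∈ A, (-1 : ℂ) ^ ((e k).2).card *
      ∏ a ∈ u i, (tx p₀ none a + ∑ q ∈ (e k).2, tx p₀ (some q) a) = F (e k).2 := fun _ _ => rfl
  rw [Finset.sum_congr rfl hF', hre]
  exact alt_sum_prod_eq_zero (fun q a => tx p₀ (some q) a) t (u i) (fun a => tx p₀ none a) J₀ (hu i)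
    (lt_of_le_of_lt (hu i) hk₀)

/-! ## 4. Packaged for the line's families -/

/-- **Necessary condition (T) for the join stubs.** Let `e` be an injective strict threshold join family (the shape quantified in
`Stmt.stub_universalJoinWide` / `Stmt.stub_qjoinSharp`). If it is good — some table gives a nonsingular block-additive matrix —
against a row family all of whose sets have size `≤ t`, then every member has at most `t` states. -/
theorem card_le_of_good (u : Fin r → Finset (Fin h)) (t : ℕ) (hu : ∀ i, (u i).card ≤ t)
    (e : Fin r → Fin m × Finset (Fin K)) (he : Function.Injective e) (W : Fin m → ℕ) (wt : Fin m → Fin K → ℕ)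
    (hthr : ∀ x : Fin m × Finset (Fin K), x ∉ Set.range e →
      ∀ i, W (e i).1 + ∑ k ∈ (e i).2, wt (e i).1 k < W x.1 + ∑ k ∈ x.2, wt x.1 k)
    (hgood : ∃ tx : Fin m → Option (Fin K) → Fin h → ℂ,
      (Matrix.of fun i k : Fin r =>
        ∏ a ∈ u i, (tx (e k).1 none a + ∑ q ∈ (e k).2, tx (e k).1 (some q) a)).det ≠ 0)
    (k : Fin r) : ((e k).2).card ≤ t := by
  by_contra hlt
  push Not at hlt
  obtain ⟨tx, htx⟩ := hgood
  exact htx (det_eq_zero_of_large_member u t hu e he k hlt (fun S hS => mem_range_of_subset e W wt hthr k S hS) tx)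

end MemberBound

end

end Summit.ValiantsHypothesis.ValiantsHypothesis.Theorems.BarrierLever.HiddenStates
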